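import Summits.BirchSwinnertonDyer.BirchSwinnertonDyer.Theorems.ByReductionTypeAtTwoMultLowerHalfIso
import Summits.BirchSwinnertonDyer.BirchSwinnertonDyer.Theorems.ByReductionTypeAtTwoOrdIsogenyTransport
import HarnessLib

/-!
# Rank-`0` DICTIONARIES at a MULTIPLICATIVE `2`: `ord₂ f_X(0)` in BSD currency (route ByReductionTypeAtTwo,
# crux `MultLowerHalfAtTwo` = item stmt-BirchSwinnertonDyer-19923; seat bsd-2adic-mult-3, GEN 5 — file 1 of 3)

HONEST FRAMING (cell `bsd-2adic`, HUMAN RULINGS D-0036/D-0074): THEOREMS ONLY — no definition, no named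
fact, nothing asserted, closes nothing; BSD is not proved by any of this. PUBLISHED inputs are displayed
hypotheses exactly as in the seat's GEN 0–5 files: Greenberg's "analogue of Thm. 4.1" at a NON-SPLIT
multiplicative `2` (`hEC`: `X5.O1.TwoAdicEulerCharRankZeroNonsplitMult W 0`, i.e. the GUARDED twin A235′ read
at `2`, p428013) resp. at a SPLIT `2` (`X5.O1.TwoAdicEulerCharRankZeroSplitMult W 0`, A236), Gross–Zagier–
Kolyvagin (`hGZK`); at a split `2` the MEMO input Greenberg–Stevens at `2` (`hGS`).

WHAT. The datum-free core of the seat's GEN 0 chains `X5.O1.lowerBound_two_{nonsplit,split}_of_eisensteinDivisibility`: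
for `W` globally minimal, multiplicative at `2`, `L(E,1) ≠ 0`, a cyclotomic dual datum with `X` torsion, a
newform `f`, the Néron ratio `ϖ·Ω_E = Ω⁺_f` and a generator `f_X` of `char_Λ X(E/ℚ_∞)`:
* non-split (`exists_shaAn_eq_and_valuation_constantCoeff_charGen_eq_nonsplit`):
  `ord₂ f_X(0) + ord₂ #Ш_an = ord₂ #Ш + ord₂ ϖ + ord₂ [0]⁺_f + 1`;
* split (`…_split`): `ord₂ f_X(0) + ord₂ #Ш_an = ord₂ #Ш + ord₂ ϖ + ord₂ [T¹]L₂(f,1)` — Greenberg–Stevens trades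
  `𝓛₂(E)·[0]⁺_f` for the class datum `[T¹]L₂ · log₂ γ` (`ord₂ log₂ γ = 2`).
In both, everything except `ord₂ #Ш − ord₂ #Ш_an` and `ord₂ ϖ` depends on the newform `f` only — the input of
the `μ`-SHIFT LAW along isogenies (sequel `…MultIsogenyMuShift.lean`) and of the transport of the seat's typed
research object `X5.O1.MultEisensteinDivisibilityAtTwo` (`…MultIsogenyEisensteinTransport.lean`).
PARTITION (D-0054): X5@2 mult (K4ᵐ, RESIDUAL-MAP B1·O1; 1 976 book230 classes) × p = 2 — types-the-object-of
(item 19923); closes none; nothing booked.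

References: R. Greenberg, LNM 1716 (1999), §4 pp. 112–113 (analogues of Thm. 4.1 at a multiplicative prime);
B. Mazur, J. Tate, J. Teitelbaum, Invent. Math. 84 (1986) §I.14–15; R. Greenberg, G. Stevens, Invent. Math.
111 (1993); R. L. Miller, LMS J. Comput. Math. 14 (2011) Def. 1.1.
-/

set_option autoImplicit false
set_option linter.dupNamespace false

noncomputable section

open scoped Classical MatrixGroups ModularForm

open CongruenceSubgroup WeierstrassCurve Literature.NumberTheory.EllipticCurves
  Literature.NumberTheory.EllipticCurves.ModularForms Literature.NumberTheory.EllipticCurves.Greenberg1999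
  Literature.NumberTheory.EllipticCurves.Wuthrich2014 Literature.NumberTheory.Transcendental
  Literature.NumberTheory.EllipticCurves.Rank1Residual Literature.NumberTheory.EllipticCurves.Rank1Residual.Typed
  Summit.BirchSwinnertonDyer.Rank1Residual Summit.BirchSwinnertonDyer.Rank1Residual.X5
  Summit.BirchSwinnertonDyer.BirchSwinnertonDyer.Theorems.EisensteinShaCurrency
  Summit.BirchSwinnertonDyer.BirchSwinnertonDyer.Theorems.IsogenyMuShift

universe u

namespace Summit.BirchSwinnertonDyer.BirchSwinnertonDyer.Theorems.MultIsogenyShift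

/-! ## §1 Rank-`0` dictionaries at a multiplicative `2` -/

section Dictionary

variable (W : WeierstrassCurve ℚ) [W.IsElliptic] [W.IsGloballyMinimal]

/-- **The rank-`0` dictionary at a NON-SPLIT multiplicative `2` (datum-free core of the seat's GEN 0
chain).** `W` globally minimal, non-split multiplicative at `2`, `L(E,1) ≠ 0`; PUB: the guarded
Thm-4.1 analogue at `2` (`hEC`, slot `δ = 0`: `f_X(0)·#E(ℚ)(2)² ~ 2^{ord₂∏c + 1}·#Sel_{2^∞}(E/ℚ)`) and GZK
(`hGZK`: `E(ℚ)`, `Ш` finite, `#Ш_an = (L(E,1)/Ω_E)·#E(ℚ)²/∏c`). For a cyclotomic datum `(κ, γ, D)` with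
`X` torsion, a newform `f` of `E`, `ϖ·Ω_E = Ω⁺_f` and a generator `f_X` of `char_Λ X`: `#Ш_an = q ∈ ℚˣ`,
`f_X(0) ≠ 0` and **`ord₂ f_X(0) + ord₂ q = ord₂ #Ш + ord₂ ϖ + ord₂ [0]⁺_f + 1`**.
[cite: GreenbergLNM1716, §4 pp. 112–113 (analogue of Thm. 4.1, l_v = 2)] [cite: Miller2011LMS, Def. 1.1 and §1] -/
theorem exists_shaAn_eq_and_valuation_constantCoeff_charGen_eq_nonsplit
    (hEC : O1.TwoAdicEulerCharRankZeroNonsplitMult W 0)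
    (hGZK : rank_eq_analyticRank_of_analyticRank_le_one)
    (hmult : Mult W 2) (hns : ¬ W.HasSplitMultiplicativeReductionAtPrime 2)
    (hL : W.entireLFunction 1 ≠ 0)
    {κ : ZpExtension ℚ 2} {γ : Field.absoluteGaloisGroup ℚ} {N : ℕ} [NeZero N]
    {f : CuspForm (Gamma0 N) 2} (hκ : κ.IsCyclotomic) (hγ : κ.IsTopGenerator γ)
    (hγ' : IsCyclotomicVariable 2 γ) (hf : IsNewformOf W f) (D : W.SelmerDualData κ γ)
    (hX : D.IsTorsion) {ϖ : ℚ} (hϖ : (ϖ : ℝ) * W.realPeriodRat = plusPeriod f)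
    {fX : IwasawaAlgebra 2} (hchar : D.charIdeal = Ideal.span {fX}) :
    ∃ q : ℚ, shaAn W = (q : ℂ) ∧ q ≠ 0 ∧ PowerSeries.constantCoeff fX ≠ 0 ∧
      ((PowerSeries.constantCoeff fX).valuation : ℤ) + padicValRat 2 q =
        (padicValNat 2 W.shaOrder : ℤ) + padicValRat 2 ϖ + padicValRat 2 (ratPlusSymbol f 0) + 1 := by
  -- Step 0: `t = ϖ · s = L(E,1)/Ω_E`, `s = [0]⁺_f ≠ 0`, `ϖ ≠ 0`
  have hΩpos : 0 < W.realPeriodRat := W.realPeriodRat_pos_holds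
  have hϖ0 : ϖ ≠ 0 := X2.varpi_ne_zero_of_isNewformOf hf hϖ
  set s : ℚ := ratPlusSymbol f 0 with hs_def
  set t : ℚ := ϖ * s with ht_def
  have hLval : W.entireLFunction 1 = (((s : ℝ) * plusPeriod f : ℝ) : ℂ) := hf.entireLFunction_one_eq
  have hq : W.entireLFunction 1 / (W.realPeriodRat : ℂ) = ((t : ℚ) : ℂ) := by
    rw [hLval, ← hϖ, div_eq_iff (Complex.ofReal_ne_zero.mpr hΩpos.ne'), ht_def]
    push_cast
    ring
  have hs0 : s ≠ 0 := by
    intro h0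
    apply hL
    rw [hLval, h0]
    simp
  have ht0 : t ≠ 0 := mul_ne_zero hϖ0 hs0
  -- Step 1: finiteness from GZK (rank 0): `E(ℚ)`, `Ш`, `Sel_{2^∞}(E/ℚ)` finite
  obtain ⟨-, hE, hfin, hshaAn⟩ := shaAn_eq_of_L_one_div_eq hGZK W hL hq
  haveI := hE
  haveI : Finite W.sha := hfin
  have hShapfin : Finite (AddCommGroup.primaryComponent W.sha 2) :=
    Finite.of_injective _ Subtype.val_injective
  have hSelfin : Finite (W.selmerGroupPInfty 2) :=
    (W.finite_selmerGroupPInfty_iff 2).mpr ⟨hE, hShapfin⟩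
  haveI := hSelfin
  haveI : Module.Finite (IwasawaAlgebra 2) D.X := D.module_finite_holds hγ
  -- Step 2 (Greenberg's analogue of Thm. 4.1 at the non-split `2`, hypothesis `hEC`, slot `δ = 0`)
  obtain ⟨u₁, hu₁⟩ := hEC hmult hns κ γ hκ hγ hγ' D hX fX hchar hSelfin
  rw [add_zero, zpow_natCast] at hu₁
  -- Step 3 (the remaining bridges)
  haveI : NeZero (2 : ℕ) := ⟨two_ne_zero⟩
  obtain ⟨u₄, hu₄⟩ := exists_unit_torsionOrder_eq W 2
  obtain ⟨u₅, hu₅⟩ := exists_unit_natCard_eq_mul_card_primaryComponent W.sha 2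
  have hSel : Nat.card (W.selmerGroupPInfty 2) = Nat.card (AddCommGroup.primaryComponent W.sha 2) :=
    W.natCard_selmerGroupPInfty_eq_natCard_primaryComponent_sha 2
  set v := padicValNat 2 W.tamagawaProduct with hv
  set Tp : ℚ_[2] := (Nat.card (AddCommGroup.primaryComponent W.toAffine.Point 2) : ℚ_[2]) with hTp
  set Shp : ℚ_[2] := (Nat.card (AddCommGroup.primaryComponent W.sha 2) : ℚ_[2]) with hShp
  have hu₄' : (W.torsionOrder : ℚ_[2]) = ((u₄ : ℤ_[2]) : ℚ_[2]) * Tp := by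
    rw [hu₄, hTp]
    congr 1
    exact_mod_cast natCard_primaryComponent_point_congr W 2 _ _
  have hSha : (W.shaOrder : ℚ_[2]) = ((u₅ : ℤ_[2]) : ℚ_[2]) * Shp := by
    rw [WeierstrassCurve.shaOrder, hShp]
    exact hu₅
  have hSel' : (Nat.card (W.selmerGroupPInfty 2) : ℚ_[2]) = Shp := by rw [hShp, hSel]
  have hTp0 : Tp ≠ 0 := by rw [hTp]; exact_mod_cast Nat.card_pos.ne'
  have hShp0 : Shp ≠ 0 := by rw [hShp]; exact_mod_cast Nat.card_pos.ne'
  have h20 : (2 : ℚ_[2]) ≠ 0 := two_ne_zero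
  rw [hSel'] at hu₁
  -- `f_X(0) ≠ 0` (the right-hand side of the display is non-zero)
  have hfX0Q : ((PowerSeries.constantCoeff fX : ℤ_[2]) : ℚ_[2]) ≠ 0 := by
    intro h0'
    have := hu₁
    rw [h0', zero_mul] at this
    exact (mul_ne_zero (mul_ne_zero (coe_units_ne_zero 2 u₁) (pow_ne_zero _ h20)) hShp0) this.symm
  have hfX0 : PowerSeries.constantCoeff fX ≠ 0 := by
    intro h0
    exact hfX0Q (by rw [h0]; rfl)
  -- Step 4: valuations
  have hv2 : (2 : ℚ_[2]).valuation = 1 := by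
    have h2 : ((2 : ℕ) : ℚ_[2]).valuation = 1 := Padic.valuation_p
    rwa [Nat.cast_ofNat] at h2
  have hvT : Tp.valuation = (padicValNat 2 W.torsionOrder : ℤ) := by
    have h := congrArg Padic.valuation hu₄'
    rw [Padic.valuation_natCast, Padic.valuation_mul (coe_units_ne_zero 2 u₄) hTp0,
      valuation_coe_units_eq_zero, zero_add] at h
    exact h.symm
  have hvS : Shp.valuation = (padicValNat 2 W.shaOrder : ℤ) := by
    have h := congrArg Padic.valuation hSha
    rw [Padic.valuation_natCast, Padic.valuation_mul (coe_units_ne_zero 2 u₅) hShp0,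
      valuation_coe_units_eq_zero, zero_add] at h
    exact h.symm
  -- `ord₂ f_X(0) + 2·tors = (v + 1) + sha`
  have hvalfX : ((PowerSeries.constantCoeff fX).valuation : ℤ) +
      2 * (padicValNat 2 W.torsionOrder : ℤ) = ((v + 1 : ℕ) : ℤ) + (padicValNat 2 W.shaOrder : ℤ) := by
    have h := congrArg Padic.valuation hu₁
    rw [Padic.valuation_mul hfX0Q (pow_ne_zero 2 hTp0), Padic.valuation_pow,
      Padic.valuation_mul (mul_ne_zero (coe_units_ne_zero 2 u₁) (pow_ne_zero _ h20)) hShp0,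
      Padic.valuation_mul (coe_units_ne_zero 2 u₁) (pow_ne_zero _ h20), valuation_coe_units_eq_zero,
      Padic.valuation_pow, hv2, hvT, hvS, PadicInt.valuation_coe] at h
    push_cast at h ⊢
    linarith
  -- Step 5: Miller's currency `#Ш_an = t · #E(ℚ)² / ∏ c_ℓ`
  have hcard : (Nat.card W.toAffine.Point : ℚ) ≠ 0 := by
    exact_mod_cast (Nat.card_pos (α := W.toAffine.Point)).ne'
  have htam : (W.tamagawaProduct : ℚ) ≠ 0 := by
    exact_mod_cast (W.tamagawaProduct_pos_holds : 0 < W.tamagawaProduct).ne'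
  have hcardT : (Nat.card W.toAffine.Point : ℚ) = (W.torsionOrder : ℚ) := by
    exact_mod_cast (W.torsionOrder_eq_natCard_of_finite).symm
  have hq0 : t * (Nat.card W.toAffine.Point : ℚ) ^ 2 / (W.tamagawaProduct : ℚ) ≠ 0 :=
    div_ne_zero (mul_ne_zero ht0 (pow_ne_zero 2 hcard)) htam
  have hvq : padicValRat 2 (t * (Nat.card W.toAffine.Point : ℚ) ^ 2 / (W.tamagawaProduct : ℚ)) =
      padicValRat 2 ϖ + padicValRat 2 s + 2 * (padicValNat 2 W.torsionOrder : ℤ) - v := by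
    rw [padicValRat.div (mul_ne_zero ht0 (pow_ne_zero 2 hcard)) htam,
      padicValRat.mul ht0 (pow_ne_zero 2 hcard), padicValRat.pow, hcardT, ht_def,
      padicValRat.mul hϖ0 hs0]
    simp only [padicValRat.of_nat, Nat.cast_ofNat, hv]
  refine ⟨t * (Nat.card W.toAffine.Point : ℚ) ^ 2 / (W.tamagawaProduct : ℚ), hshaAn, hq0, hfX0, ?_⟩
  rw [hvq]
  push_cast at hvalfX ⊢
  linarith

/-- **The rank-`0` dictionary at a SPLIT multiplicative `2`.** `W` globally minimal, split multiplicative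
at `2`, `L(E,1) ≠ 0`; PUB: the split Thm-4.1 analogue at `2` (`hEC`, A236, slot `δ = 0`:
`f_X(0)·#E(ℚ)(2)² ~ (𝓛₂(E)/4)·2^{ord₂∏c}·#Sel_{2^∞}(E/ℚ)` for a Tate datum with `log₂ q_E ≠ 0`) and GZK;
MEMO: Greenberg–Stevens at `2` (`hGS`: `[T¹]L · log₂ γ = 𝓛₂(E)·[0]⁺_f`, `ord₂ log₂ γ = 2`). For a cyclotomic
datum with `X` torsion, a newform `f`, a split `2`-adic `L`-function `L` of `f`, `ϖ·Ω_E = Ω⁺_f` and a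
generator `f_X`: `#Ш_an = q ∈ ℚˣ`, `f_X(0) ≠ 0`, `[T¹]L ≠ 0` and
**`ord₂ f_X(0) + ord₂ q = ord₂ #Ш + ord₂ ϖ + ord₂ [T¹]L`** (the `𝓛`-invariant and `[0]⁺_f` have been traded
for the class datum `[T¹]L`). The Tate datum is discharged inside (`nonempty_tateParameterData_iff_holds`,
`TateParameterData.padicLog_q_ne_zero`). [cite: GreenbergLNM1716, §4 pp. 112–113 (analogue of Thm. 4.1, split l_v)]
[cite: GreenbergStevens1993, Theorem of the Introduction (shape; p ≥ 5 in print)] [cite: Miller2011LMS, Def. 1.1 and §1] -/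
theorem exists_shaAn_eq_and_valuation_constantCoeff_charGen_eq_split
    (hEC : O1.TwoAdicEulerCharRankZeroSplitMult W 0)
    (hGZK : rank_eq_analyticRank_of_analyticRank_le_one)
    (hGS : greenberg_stevens (W := W) (p := 2))
    (hmult : Mult W 2) (hsp : W.HasSplitMultiplicativeReductionAtPrime 2)
    (hL : W.entireLFunction 1 ≠ 0)
    {κ : ZpExtension ℚ 2} {γ : Field.absoluteGaloisGroup ℚ} {N : ℕ} [NeZero N]
    {f : CuspForm (Gamma0 N) 2} (hκ : κ.IsCyclotomic) (hγ : κ.IsTopGenerator γ)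
    (hγ' : IsCyclotomicVariable 2 γ) (hf : IsNewformOf W f) {L : PowerSeries ℚ_[2]}
    (hLf : IsSplitMultPAdicLFunctionOf f 2 L) (D : W.SelmerDualData κ γ)
    (hX : D.IsTorsion) {ϖ : ℚ} (hϖ : (ϖ : ℝ) * W.realPeriodRat = plusPeriod f)
    {fX : IwasawaAlgebra 2} (hchar : D.charIdeal = Ideal.span {fX}) :
    ∃ q : ℚ, shaAn W = (q : ℂ) ∧ q ≠ 0 ∧ PowerSeries.constantCoeff fX ≠ 0 ∧
      PowerSeries.coeff 1 L ≠ 0 ∧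
      ((PowerSeries.constantCoeff fX).valuation : ℤ) + padicValRat 2 q =
        (padicValNat 2 W.shaOrder : ℤ) + padicValRat 2 ϖ + (PowerSeries.coeff 1 L).valuation := by
  -- Step 0: `t = ϖ · s = L(E,1)/Ω_E`, `s = [0]⁺_f ≠ 0`, `ϖ ≠ 0`
  have hΩpos : 0 < W.realPeriodRat := W.realPeriodRat_pos_holds
  have hϖ0 : ϖ ≠ 0 := X2.varpi_ne_zero_of_isNewformOf hf hϖ
  set s : ℚ := ratPlusSymbol f 0 with hs_def
  set t : ℚ := ϖ * s with ht_def
  have hLval : W.entireLFunction 1 = (((s : ℝ) * plusPeriod f : ℝ) : ℂ) := hf.entireLFunction_one_eq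
  have hq : W.entireLFunction 1 / (W.realPeriodRat : ℂ) = ((t : ℚ) : ℂ) := by
    rw [hLval, ← hϖ, div_eq_iff (Complex.ofReal_ne_zero.mpr hΩpos.ne'), ht_def]
    push_cast
    ring
  have hs0 : s ≠ 0 := by
    intro h0
    apply hL
    rw [hLval, h0]
    simp
  have ht0 : t ≠ 0 := mul_ne_zero hϖ0 hs0
  have hsQ0 : (s : ℚ_[2]) ≠ 0 := by exact_mod_cast hs0
  -- Step 1: finiteness from GZK (rank 0)
  obtain ⟨-, hE, hfin, hshaAn⟩ := shaAn_eq_of_L_one_div_eq hGZK W hL hq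
  haveI := hE
  haveI : Finite W.sha := hfin
  have hShapfin : Finite (AddCommGroup.primaryComponent W.sha 2) :=
    Finite.of_injective _ Subtype.val_injective
  have hSelfin : Finite (W.selmerGroupPInfty 2) :=
    (W.finite_selmerGroupPInfty_iff 2).mpr ⟨hE, hShapfin⟩
  haveI := hSelfin
  haveI : Module.Finite (IwasawaAlgebra 2) D.X := D.module_finite_holds hγ
  -- Step 2: a Tate datum with `log₂ q ≠ 0`, the split display (`δ = 0`), Greenberg–Stevens
  obtain ⟨Dq⟩ := (nonempty_tateParameterData_iff_holds (W := W) (p := 2)).mpr hsp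
  have hlog : padicLog 2 Dq.q ≠ 0 := Dq.padicLog_q_ne_zero MahlerManinPadic_holds
  obtain ⟨u₁, hu₁⟩ := hEC hmult hsp κ γ hκ hγ hγ' D hX fX hchar hSelfin Dq hlog
  rw [add_zero, zpow_natCast] at hu₁
  obtain ⟨-, hGS1⟩ := hGS Dq hf hLf
  have hlog0 := O1.padicLog_cyclotomicGenerator_two_ne_zero
  have hLI : LInvariant Dq ≠ 0 := O1.lInvariant_two_ne_zero W Dq
  set c₁ : ℚ_[2] := PowerSeries.coeff 1 L with hc₁_def
  have hc₁0 : c₁ ≠ 0 := by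
    intro h0
    have h' := hGS1
    rw [h0, zero_mul] at h'
    exact mul_ne_zero hLI hsQ0 h'.symm
  -- `ord₂ c₁ + 2 = ord₂ 𝓛 + ord₂ s`
  have hvc₁ : c₁.valuation + 2 = (LInvariant Dq).valuation + padicValRat 2 s := by
    have h := congrArg Padic.valuation hGS1
    rw [Padic.valuation_mul hc₁0 hlog0, O1.valuation_padicLog_cyclotomicGenerator_two,
      Padic.valuation_mul hLI hsQ0, Padic.valuation_ratCast] at h
    exact h
  -- Step 3 (the remaining bridges)
  haveI : NeZero (2 : ℕ) := ⟨two_ne_zero⟩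
  obtain ⟨u₄, hu₄⟩ := exists_unit_torsionOrder_eq W 2
  obtain ⟨u₅, hu₅⟩ := exists_unit_natCard_eq_mul_card_primaryComponent W.sha 2
  have hSel : Nat.card (W.selmerGroupPInfty 2) = Nat.card (AddCommGroup.primaryComponent W.sha 2) :=
    W.natCard_selmerGroupPInfty_eq_natCard_primaryComponent_sha 2
  set v := padicValNat 2 W.tamagawaProduct with hv
  set Tp : ℚ_[2] := (Nat.card (AddCommGroup.primaryComponent W.toAffine.Point 2) : ℚ_[2]) with hTp
  set Shp : ℚ_[2] := (Nat.card (AddCommGroup.primaryComponent W.sha 2) : ℚ_[2]) with hShp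
  set ℓ4 : ℚ_[2] := LInvariant Dq / 4 with hℓ4
  have h20 : (2 : ℚ_[2]) ≠ 0 := two_ne_zero
  have h40 : (4 : ℚ_[2]) ≠ 0 := by norm_num
  have hℓ40 : ℓ4 ≠ 0 := by rw [hℓ4]; exact div_ne_zero hLI h40
  have hv2 : (2 : ℚ_[2]).valuation = 1 := by
    have h2 : ((2 : ℕ) : ℚ_[2]).valuation = 1 := Padic.valuation_p
    rwa [Nat.cast_ofNat] at h2
  have hv4 : (4 : ℚ_[2]).valuation = 2 := by
    rw [show (4 : ℚ_[2]) = 2 * 2 by norm_num, Padic.valuation_mul h20 h20, hv2]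
    norm_num
  have hvℓ4 : ℓ4.valuation = (LInvariant Dq).valuation - 2 := by
    rw [hℓ4, div_eq_mul_inv, Padic.valuation_mul hLI (inv_ne_zero h40), Padic.valuation_inv, hv4]
    ring
  have hu₄' : (W.torsionOrder : ℚ_[2]) = ((u₄ : ℤ_[2]) : ℚ_[2]) * Tp := by
    rw [hu₄, hTp]
    congr 1
    exact_mod_cast natCard_primaryComponent_point_congr W 2 _ _
  have hSha : (W.shaOrder : ℚ_[2]) = ((u₅ : ℤ_[2]) : ℚ_[2]) * Shp := by
    rw [WeierstrassCurve.shaOrder, hShp]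
    exact hu₅
  have hSel' : (Nat.card (W.selmerGroupPInfty 2) : ℚ_[2]) = Shp := by rw [hShp, hSel]
  have hTp0 : Tp ≠ 0 := by rw [hTp]; exact_mod_cast Nat.card_pos.ne'
  have hShp0 : Shp ≠ 0 := by rw [hShp]; exact_mod_cast Nat.card_pos.ne'
  rw [hSel'] at hu₁
  -- `f_X(0) ≠ 0`
  have hfX0Q : ((PowerSeries.constantCoeff fX : ℤ_[2]) : ℚ_[2]) ≠ 0 := by
    intro h0'
    have := hu₁
    rw [h0', zero_mul] at this
    exact (mul_ne_zero (mul_ne_zero (mul_ne_zero (coe_units_ne_zero 2 u₁) hℓ40)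
      (pow_ne_zero _ h20)) hShp0) this.symm
  have hfX0 : PowerSeries.constantCoeff fX ≠ 0 := by
    intro h0
    exact hfX0Q (by rw [h0]; rfl)
  -- Step 4: valuations
  have hvT : Tp.valuation = (padicValNat 2 W.torsionOrder : ℤ) := by
    have h := congrArg Padic.valuation hu₄'
    rw [Padic.valuation_natCast, Padic.valuation_mul (coe_units_ne_zero 2 u₄) hTp0,
      valuation_coe_units_eq_zero, zero_add] at h
    exact h.symm
  have hvS : Shp.valuation = (padicValNat 2 W.shaOrder : ℤ) := by
    have h := congrArg Padic.valuation hSha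
    rw [Padic.valuation_natCast, Padic.valuation_mul (coe_units_ne_zero 2 u₅) hShp0,
      valuation_coe_units_eq_zero, zero_add] at h
    exact h.symm
  -- `ord₂ f_X(0) + 2·tors = (ord₂ 𝓛 − 2) + v + sha`
  have hvalfX : ((PowerSeries.constantCoeff fX).valuation : ℤ) +
      2 * (padicValNat 2 W.torsionOrder : ℤ) =
        ((LInvariant Dq).valuation - 2) + (v : ℤ) + (padicValNat 2 W.shaOrder : ℤ) := by
    have h := congrArg Padic.valuation hu₁
    have hu₁0 : ((u₁ : ℤ_[2]) : ℚ_[2]) ≠ 0 := coe_units_ne_zero 2 u₁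
    rw [Padic.valuation_mul hfX0Q (pow_ne_zero 2 hTp0), Padic.valuation_pow,
      Padic.valuation_mul (mul_ne_zero (mul_ne_zero hu₁0 hℓ40) (pow_ne_zero _ h20)) hShp0,
      Padic.valuation_mul (mul_ne_zero hu₁0 hℓ40) (pow_ne_zero _ h20),
      Padic.valuation_mul hu₁0 hℓ40, valuation_coe_units_eq_zero, Padic.valuation_pow, hv2, hvT, hvS,
      hvℓ4, PadicInt.valuation_coe] at h
    push_cast at h ⊢
    linarith
  -- Step 5: Miller's currency `#Ш_an = t · #E(ℚ)² / ∏ c_ℓ`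
  have hcard : (Nat.card W.toAffine.Point : ℚ) ≠ 0 := by
    exact_mod_cast (Nat.card_pos (α := W.toAffine.Point)).ne'
  have htam : (W.tamagawaProduct : ℚ) ≠ 0 := by
    exact_mod_cast (W.tamagawaProduct_pos_holds : 0 < W.tamagawaProduct).ne'
  have hcardT : (Nat.card W.toAffine.Point : ℚ) = (W.torsionOrder : ℚ) := by
    exact_mod_cast (W.torsionOrder_eq_natCard_of_finite).symm
  have hq0 : t * (Nat.card W.toAffine.Point : ℚ) ^ 2 / (W.tamagawaProduct : ℚ) ≠ 0 :=
    div_ne_zero (mul_ne_zero ht0 (pow_ne_zero 2 hcard)) htam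
  have hvq : padicValRat 2 (t * (Nat.card W.toAffine.Point : ℚ) ^ 2 / (W.tamagawaProduct : ℚ)) =
      padicValRat 2 ϖ + padicValRat 2 s + 2 * (padicValNat 2 W.torsionOrder : ℤ) - v := by
    rw [padicValRat.div (mul_ne_zero ht0 (pow_ne_zero 2 hcard)) htam,
      padicValRat.mul ht0 (pow_ne_zero 2 hcard), padicValRat.pow, hcardT, ht_def,
      padicValRat.mul hϖ0 hs0]
    simp only [padicValRat.of_nat, Nat.cast_ofNat, hv]
  refine ⟨t * (Nat.card W.toAffine.Point : ℚ) ^ 2 / (W.tamagawaProduct : ℚ), hshaAn, hq0, hfX0, hc₁0, ?_⟩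
  rw [hvq]
  linarith

end Dictionary

end Summit.BirchSwinnertonDyer.BirchSwinnertonDyer.Theorems.MultIsogenyShift

end
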